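import Summits.CriticalPhenomena.PercolationContinuityZ3.Theorems.PercNearOneGluingNoHeavyLowerTailAntitheticOneSidedCubes
import Summits.CriticalPhenomena.PercolationContinuityZ3.Theorems.PercNearOneGluingNoHeavyLowerTailAntitheticTermOne
import HarnessLib

/-!
# `NoHeavyLowerTail` (stmt-CriticalPhenomena-4575) — antithetic cluster pairs: the CUT-VERTEX COMPOSITION THEOREM (THEOREM OS⊕-C of
# HOME/THEOREM-OneSided.md, prim-hp-2 gen 56), graph side

Support file (`--supports stmt-CriticalPhenomena-4575`, hull-port prover `prim-hp-2`, gen 56).  No definitions, no named facts, no sorries;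
standard axioms.  VERTEX version.

SETTING.  Two edge sets `E₁, E₂` on disjoint vertex sets `U₁, U₂` glued at the source `s` (every pair of `Eᵢ` has its entries in
`{s} ∪ Uᵢ`), `y ∈ U₁`, `z ∈ U₂`, a bonus vertex `x`; `Xᵢ(ω) = openCluster (ω ∩ Eᵢ) s`, `Yᵢ(ω) = openCluster (ωᶜ ∩ Eᵢ) s`, and
`X = X₁ ∪ X₂`, `Y = Y₁ ∪ Y₂` are the clusters of `E₁ ∪ E₂` (`Cut.cluster_union`: a cut vertex splits clusters).

**THEOREM OS⊕-C** (`Antithetic.cutVertex_termTwo_nonneg`).  If side 1 is ⊕-POSITIVE at `y` — for all twisted-monotone SUPER-ODD `K₁, K₂`,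
`Σ_{ω : y ∈ X₁ ω} K₁(X₁ ω, Y₁ ω)·K₂(X₁ ω, Y₁ ω) ≥ 0` — then for all monotone vertex functions `F, G`
`0 ≤ Σ_{ω : y ∈ X ω, z ∉ Y ω} (F(X ω ∪ {x}) − F(Y ω))·(G(X ω ∪ {x}) − G(Y ω))`,
i.e. TERM II of the deg-2 elimination (`DegTwo.deg2_vertex_reduction`, …AntitheticDegTwoVertex) is nonnegative WHATEVER side 2 is.  With
`DegTwo.deg2_vertex_of_termTwo` this proves the vertex antithetic conjecture at `R = {x}` for every degree-2 `x` whose neighbours are separated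
by `s` in `G − x` and whose `y`-side is ⊕-positive — e.g. FAT8 (both sides cherry fans; MEMO-gen54's counterexample to symmetric Harris trees),
once the cherry's 23-colouring certificate (HOME/THEOREM-OneSided.md) is supplied.
Proof (HOME/THEOREM-OneSided.md): double the colouring (`ω₁` for side 1, `ω₂` for side 2 — the diagonal sum is the double sum divided by
`2^{|Sym2 V|}`, `Cut.double_eq`); partition `{z ∉ Y₂}` by BLOCK FREEZING of the blue cluster of `z` (…AntitheticTermOne, `Freeze.*`, applied to
the complementary colouring); on each part side 2 is a red-dominated cube in the free pairs, and `Antithetic.oplus_composition_sum_nonneg`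
(…AntitheticOneSidedCubes) combines it with the ⊕-positive side 1.
[cite: VandenbergHaggstromKahn2005, §1 p. 6 ("Harris' inequality"), §1 p. 3 (open cluster `C_s`)]
-/

noncomputable section

namespace Summit.CriticalPhenomena.PercolationContinuityZ3.Theorems

open Literature.Probability.Percolation
open scoped Classical

namespace Antithetic

namespace Cut

variable {V : Type*}

/-- Closed sets contain everything reachable (walk induction). [folklore] -/
theorem reach_closed' {Gr : SimpleGraph V} {P : V → Prop} (hcl : ∀ u w, P u → Gr.Adj u w → P w) {a u : V}
    (h : Gr.Reachable a u) (ha : P a) : P u := by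
  obtain ⟨p⟩ := h
  induction p with
  | nil => exact ha
  | cons hadj _ ih => exact ih (hcl _ _ ha hadj)

/-- The cluster of `s` in a side stays in that side. [folklore] -/
theorem cluster_subset_side {E₁ : Set (Sym2 V)} {s : V} {U₁ : Set V} (hE₁ : ∀ e ∈ E₁, ∀ v ∈ e, v = s ∨ v ∈ U₁)
    (η : Set (Sym2 V)) : openCluster (η ∩ E₁) s ⊆ insert s U₁ := by
  intro v hv
  refine reach_closed' (P := fun v => v ∈ insert s U₁) (fun u w _ huw => ?_) hv (Set.mem_insert _ _)
  rw [openGraph_adj] at huw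
  rcases hE₁ _ huw.1.2 w (Sym2.mem_mk_right u w) with h | h
  · exact h ▸ Set.mem_insert _ _
  · exact Set.mem_insert_of_mem _ h

/-- **A cut vertex splits clusters**: with the two sides glued at `s` only, the cluster of `s` in `E₁ ∪ E₂` is the union of the clusters
in `E₁` and in `E₂` (for any colouring `η`, e.g. `ω` or `ωᶜ`). [folklore] -/
theorem cluster_union {E₁ E₂ : Set (Sym2 V)} {s : V} {U₁ U₂ : Set V} (hU : Disjoint U₁ U₂) (hs₁ : s ∉ U₁) (hs₂ : s ∉ U₂)
    (hE₁ : ∀ e ∈ E₁, ∀ v ∈ e, v = s ∨ v ∈ U₁) (hE₂ : ∀ e ∈ E₂, ∀ v ∈ e, v = s ∨ v ∈ U₂) (η : Set (Sym2 V)) :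
    openCluster (η ∩ (E₁ ∪ E₂)) s = openCluster (η ∩ E₁) s ∪ openCluster (η ∩ E₂) s := by
  apply Set.Subset.antisymm
  · intro v hv
    refine reach_closed' (P := fun v => v ∈ openCluster (η ∩ E₁) s ∪ openCluster (η ∩ E₂) s) (fun u w hu huw => ?_) hv
      (Or.inl (mem_openCluster_self _ _))
    rw [openGraph_adj] at huw
    obtain ⟨⟨hη, hE⟩, hne⟩ := huw
    rcases hE with hE | hE
    · -- an `E₁`-pair: its entries lie in `{s} ∪ U₁`
      have hadj : (openGraph (η ∩ E₁)).Adj u w := by rw [openGraph_adj]; exact ⟨⟨hη, hE⟩, hne⟩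
      rcases hu with hu | hu
      · exact Or.inl (SimpleGraph.Reachable.trans hu hadj.reachable)
      · -- `u` in the side-2 cluster and on an `E₁`-pair: `u = s`
        have hu2 := cluster_subset_side hE₂ η hu
        rcases hE₁ _ hE u (Sym2.mem_mk_left u w) with h | h
        · subst h; exact Or.inl hadj.reachable
        · rcases hu2 with h2 | h2
          · exact absurd h2 (fun h2 => hs₁ (h2 ▸ h))
          · exact absurd (Set.disjoint_left.1 hU h) (not_not.2 h2)
    · have hadj : (openGraph (η ∩ E₂)).Adj u w := by rw [openGraph_adj]; exact ⟨⟨hη, hE⟩, hne⟩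
      rcases hu with hu | hu
      · have hu1 := cluster_subset_side hE₁ η hu
        rcases hE₂ _ hE u (Sym2.mem_mk_left u w) with h | h
        · subst h; exact Or.inr hadj.reachable
        · rcases hu1 with h1 | h1
          · exact absurd h1 (fun h1 => hs₂ (h1 ▸ h))
          · exact absurd h (Set.disjoint_left.1 hU h1)
      · exact Or.inr (SimpleGraph.Reachable.trans hu hadj.reachable)
  · have m1 : η ∩ E₁ ⊆ η ∩ (E₁ ∪ E₂) := Set.inter_subset_inter_right _ Set.subset_union_left
    have m2 : η ∩ E₂ ⊆ η ∩ (E₁ ∪ E₂) := Set.inter_subset_inter_right _ Set.subset_union_right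
    exact Set.union_subset (Freeze.openCluster_mono m1 s) (Freeze.openCluster_mono m2 s)

/-- A vertex of side 1 is never in the side-2 cluster. [folklore] -/
theorem not_mem_cluster_other {E₂ : Set (Sym2 V)} {s y : V} {U₁ U₂ : Set V} (hU : Disjoint U₁ U₂) (hs₁ : s ∉ U₁)
    (hE₂ : ∀ e ∈ E₂, ∀ v ∈ e, v = s ∨ v ∈ U₂) (hy : y ∈ U₁) (η : Set (Sym2 V)) : y ∉ openCluster (η ∩ E₂) s := by
  intro h
  rcases cluster_subset_side hE₂ η h with h | h
  · exact hs₁ (h ▸ hy)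
  · exact Set.disjoint_left.1 hU hy h

section Main

variable [Fintype V]

omit [Fintype V] in
/-- **Grafting**: exchanging the `E₂`-parts of two colourings is an involution of pairs of colourings. [folklore] -/
theorem graft_graft (E₂ : Set (Sym2 V)) (p : Set (Sym2 V) × Set (Sym2 V)) :
    (fun p : Set (Sym2 V) × Set (Sym2 V) => ((p.1 \ E₂) ∪ (p.2 ∩ E₂), (p.2 \ E₂) ∪ (p.1 ∩ E₂)))
      ((fun p : Set (Sym2 V) × Set (Sym2 V) => ((p.1 \ E₂) ∪ (p.2 ∩ E₂), (p.2 \ E₂) ∪ (p.1 ∩ E₂))) p) = p := by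
  obtain ⟨a, b⟩ := p
  ext e <;> simp only [Set.mem_union, Set.mem_sdiff, Set.mem_inter_iff] <;> tauto

/-- **THEOREM OS⊕-C (cut-vertex composition)**, HOME/THEOREM-OneSided.md: if side 1 is ⊕-positive at `y`, TERM II over `E₁ ∪ E₂` is
nonnegative whatever side 2 is. [this work] -/
theorem cutVertex_termTwo_nonneg (E₁ E₂ : Set (Sym2 V)) (s y z x : V) (U₁ U₂ : Set V) (hU : Disjoint U₁ U₂) (hs₁ : s ∉ U₁)
    (hs₂ : s ∉ U₂) (hE₁ : ∀ e ∈ E₁, ∀ v ∈ e, v = s ∨ v ∈ U₁) (hE₂ : ∀ e ∈ E₂, ∀ v ∈ e, v = s ∨ v ∈ U₂)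
    (hdis : Disjoint E₁ E₂) (hy : y ∈ U₁) (hz : z ∈ U₂)
    (hplus : ∀ K₁ K₂ : Set V → Set V → ℝ,
      (∀ ⦃P P' Q Q' : Set V⦄, P ⊆ P' → Q' ⊆ Q → K₁ P Q ≤ K₁ P' Q') → (∀ P Q, 0 ≤ K₁ P Q + K₁ Q P) →
      (∀ ⦃P P' Q Q' : Set V⦄, P ⊆ P' → Q' ⊆ Q → K₂ P Q ≤ K₂ P' Q') → (∀ P Q, 0 ≤ K₂ P Q + K₂ Q P) →
      0 ≤ ∑ ω ∈ Finset.univ.filter (fun ω : Set (Sym2 V) => y ∈ openCluster (ω ∩ E₁) s),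
        K₁ (openCluster (ω ∩ E₁) s) (openCluster (ωᶜ ∩ E₁) s) * K₂ (openCluster (ω ∩ E₁) s) (openCluster (ωᶜ ∩ E₁) s))
    {F G : Set V → ℝ} (hF : Monotone F) (hG : Monotone G) :
    0 ≤ ∑ ω ∈ Finset.univ.filter (fun ω : Set (Sym2 V) =>
        (openGraph (ω ∩ (E₁ ∪ E₂))).Reachable s y ∧ ¬ (openGraph (ωᶜ ∩ (E₁ ∪ E₂))).Reachable s z),
      (F (openCluster (ω ∩ (E₁ ∪ E₂)) s ∪ {x}) - F (openCluster (ωᶜ ∩ (E₁ ∪ E₂)) s)) *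
        (G (openCluster (ω ∩ (E₁ ∪ E₂)) s ∪ {x}) - G (openCluster (ωᶜ ∩ (E₁ ∪ E₂)) s)) := by
  -- notation
  let X₁ : Set (Sym2 V) → Set V := fun ω => openCluster (ω ∩ E₁) s
  let Y₁ : Set (Sym2 V) → Set V := fun ω => openCluster (ωᶜ ∩ E₁) s
  let X₂ : Set (Sym2 V) → Set V := fun ω => openCluster (ω ∩ E₂) s
  let Y₂ : Set (Sym2 V) → Set V := fun ω => openCluster (ωᶜ ∩ E₂) s
  let hh : Set V → Set V → ℝ := fun P Q => (F P - F Q) * (G P - G Q)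
  let Ψ₂ : Set (Sym2 V) → Set (Sym2 V) → ℝ := fun ω₁ ω₂ =>
    if y ∈ X₁ ω₁ ∧ z ∉ Y₂ ω₂ then hh (X₁ ω₁ ∪ X₂ ω₂ ∪ {x}) (Y₁ ω₁ ∪ Y₂ ω₂) else 0
  have hdis' : ∀ e, e ∈ E₁ → e ∉ E₂ := fun e h1 h2 => Set.disjoint_left.1 hdis h1 h2
  -- (1) the target is the diagonal of `Ψ₂`
  have hdiag : ∑ ω ∈ Finset.univ.filter (fun ω : Set (Sym2 V) =>
        (openGraph (ω ∩ (E₁ ∪ E₂))).Reachable s y ∧ ¬ (openGraph (ωᶜ ∩ (E₁ ∪ E₂))).Reachable s z),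
      (F (openCluster (ω ∩ (E₁ ∪ E₂)) s ∪ {x}) - F (openCluster (ωᶜ ∩ (E₁ ∪ E₂)) s)) *
        (G (openCluster (ω ∩ (E₁ ∪ E₂)) s ∪ {x}) - G (openCluster (ωᶜ ∩ (E₁ ∪ E₂)) s)) = ∑ ω, Ψ₂ ω ω := by
    rw [Finset.sum_filter]
    refine Finset.sum_congr rfl fun ω _ => ?_
    have e1 : openCluster (ω ∩ (E₁ ∪ E₂)) s = X₁ ω ∪ X₂ ω := cluster_union hU hs₁ hs₂ hE₁ hE₂ ω
    have e2 : openCluster (ωᶜ ∩ (E₁ ∪ E₂)) s = Y₁ ω ∪ Y₂ ω := cluster_union hU hs₁ hs₂ hE₁ hE₂ ωᶜ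
    have c1 : (openGraph (ω ∩ (E₁ ∪ E₂))).Reachable s y ↔ y ∈ X₁ ω := by
      change y ∈ openCluster (ω ∩ (E₁ ∪ E₂)) s ↔ _
      rw [e1, Set.mem_union]
      exact ⟨fun h => h.resolve_right (not_mem_cluster_other hU hs₁ hE₂ hy ω), Or.inl⟩
    have c2 : (openGraph (ωᶜ ∩ (E₁ ∪ E₂))).Reachable s z ↔ z ∈ Y₂ ω := by
      change z ∈ openCluster (ωᶜ ∩ (E₁ ∪ E₂)) s ↔ _
      rw [e2, Set.mem_union]
      exact ⟨fun h => h.resolve_left (not_mem_cluster_other hU.symm hs₂ hE₁ hz ωᶜ), Or.inr⟩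
    rw [e1, e2]
    show (if (openGraph (ω ∩ (E₁ ∪ E₂))).Reachable s y ∧ ¬ (openGraph (ωᶜ ∩ (E₁ ∪ E₂))).Reachable s z then
        hh (X₁ ω ∪ X₂ ω ∪ {x}) (Y₁ ω ∪ Y₂ ω) else 0) =
      if y ∈ X₁ ω ∧ z ∉ Y₂ ω then hh (X₁ ω ∪ X₂ ω ∪ {x}) (Y₁ ω ∪ Y₂ ω) else 0
    by_cases h : y ∈ X₁ ω ∧ z ∉ Y₂ ω
    · have h' : (openGraph (ω ∩ (E₁ ∪ E₂))).Reachable s y ∧ ¬ (openGraph (ωᶜ ∩ (E₁ ∪ E₂))).Reachable s z :=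
        ⟨c1.2 h.1, fun hz' => h.2 (c2.1 hz')⟩
      rw [if_pos h', if_pos h]
    · have h' : ¬ ((openGraph (ω ∩ (E₁ ∪ E₂))).Reachable s y ∧ ¬ (openGraph (ωᶜ ∩ (E₁ ∪ E₂))).Reachable s z) :=
        fun hh' => h ⟨c1.1 hh'.1, fun hz' => hh'.2 (c2.2 hz')⟩
      rw [if_neg h', if_neg h]
  -- (2) grafting: the double sum is `|Set (Sym2 V)|` times the diagonal
  let θ : Set (Sym2 V) × Set (Sym2 V) → Set (Sym2 V) × Set (Sym2 V) :=
    fun p => ((p.1 \ E₂) ∪ (p.2 ∩ E₂), (p.2 \ E₂) ∪ (p.1 ∩ E₂))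
  have hθ : Function.Involutive θ := fun p => graft_graft E₂ p
  have g1 : ∀ a b : Set (Sym2 V), ((a \ E₂) ∪ (b ∩ E₂)) ∩ E₁ = a ∩ E₁ := by
    intro a b; ext e
    simp only [Set.mem_inter_iff, Set.mem_union, Set.mem_sdiff]
    constructor
    · rintro ⟨h | h, he⟩
      · exact ⟨h.1, he⟩
      · exact absurd h.2 (hdis' e he)
    · rintro ⟨ha, he⟩; exact ⟨Or.inl ⟨ha, hdis' e he⟩, he⟩
  have g2 : ∀ a b : Set (Sym2 V), ((a \ E₂) ∪ (b ∩ E₂))ᶜ ∩ E₁ = aᶜ ∩ E₁ := by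
    intro a b; ext e
    simp only [Set.mem_inter_iff, Set.mem_compl_iff, Set.mem_union, Set.mem_sdiff, not_or, not_and, not_not]
    constructor
    · rintro ⟨⟨h1, _⟩, he⟩; exact ⟨fun ha => hdis' e he (h1 ha), he⟩
    · rintro ⟨ha, he⟩; exact ⟨⟨fun ha' => absurd ha' ha, fun _ he2 => absurd he2 (hdis' e he)⟩, he⟩
  have g3 : ∀ a b : Set (Sym2 V), ((a \ E₂) ∪ (b ∩ E₂)) ∩ E₂ = b ∩ E₂ := by
    intro a b; ext e
    simp only [Set.mem_inter_iff, Set.mem_union, Set.mem_sdiff]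
    constructor
    · rintro ⟨h | h, he⟩
      · exact absurd he h.2
      · exact ⟨h.1, he⟩
    · rintro ⟨hb, he⟩; exact ⟨Or.inr ⟨hb, he⟩, he⟩
  have g4 : ∀ a b : Set (Sym2 V), ((a \ E₂) ∪ (b ∩ E₂))ᶜ ∩ E₂ = bᶜ ∩ E₂ := by
    intro a b; ext e
    simp only [Set.mem_inter_iff, Set.mem_compl_iff, Set.mem_union, Set.mem_sdiff, not_or, not_and, not_not]
    constructor
    · rintro ⟨⟨_, h2⟩, he⟩; exact ⟨fun hb => absurd he (h2 hb), he⟩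
    · rintro ⟨hb, he⟩; exact ⟨⟨fun _ => he, fun hb' => absurd hb' hb⟩, he⟩
  have hΨθ : ∀ p : Set (Sym2 V) × Set (Sym2 V), Ψ₂ p.1 p.2 = Ψ₂ (θ p).1 (θ p).1 := by
    intro p
    have a1 : X₁ (θ p).1 = X₁ p.1 := by show openCluster (((p.1 \ E₂) ∪ (p.2 ∩ E₂)) ∩ E₁) s = _; rw [g1]
    have a2 : Y₁ (θ p).1 = Y₁ p.1 := by show openCluster (((p.1 \ E₂) ∪ (p.2 ∩ E₂))ᶜ ∩ E₁) s = _; rw [g2]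
    have a3 : X₂ (θ p).1 = X₂ p.2 := by show openCluster (((p.1 \ E₂) ∪ (p.2 ∩ E₂)) ∩ E₂) s = _; rw [g3]
    have a4 : Y₂ (θ p).1 = Y₂ p.2 := by show openCluster (((p.1 \ E₂) ∪ (p.2 ∩ E₂))ᶜ ∩ E₂) s = _; rw [g4]
    simp only [Ψ₂, a1, a2, a3, a4]
  have hrel : ∑ ω₁, ∑ ω₂, Ψ₂ ω₁ ω₂ = (Fintype.card (Set (Sym2 V)) : ℝ) * ∑ ω, Ψ₂ ω ω := by
    rw [← Fintype.sum_prod_type']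
    rw [show ∑ p : Set (Sym2 V) × Set (Sym2 V), Ψ₂ p.1 p.2 = ∑ p : Set (Sym2 V) × Set (Sym2 V), Ψ₂ (θ p).1 (θ p).1 from
      Fintype.sum_congr _ _ hΨθ]
    rw [Fintype.sum_bijective θ hθ.bijective (fun p => Ψ₂ (θ p).1 (θ p).1) (fun q => Ψ₂ q.1 q.1) (fun p => rfl)]
    rw [Fintype.sum_prod_type, Finset.mul_sum]
    refine Finset.sum_congr rfl fun a _ => ?_
    show ∑ _b : Set (Sym2 V), Ψ₂ a a = _
    rw [Finset.sum_const, Finset.card_univ, nsmul_eq_mul]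
  -- (3) the double sum is nonnegative: block freezing on side 2, composition with the ⊕-positive side 1
  let Φ' : Set (Sym2 V) → ℝ := fun ω₂ =>
    ∑ ω₁ ∈ Finset.univ.filter (fun ω₁ : Set (Sym2 V) => y ∈ X₁ ω₁), hh (X₁ ω₁ ∪ X₂ ω₂ ∪ {x}) (Y₁ ω₁ ∪ Y₂ ω₂)
  have hΦ : ∀ ω₂, ∑ ω₁, Ψ₂ ω₁ ω₂ = if z ∉ Y₂ ω₂ then Φ' ω₂ else 0 := by
    intro ω₂
    by_cases h : z ∉ Y₂ ω₂
    · rw [if_pos h]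
      show ∑ ω₁, Ψ₂ ω₁ ω₂ = ∑ ω₁ ∈ Finset.univ.filter (fun ω₁ : Set (Sym2 V) => y ∈ X₁ ω₁), hh (X₁ ω₁ ∪ X₂ ω₂ ∪ {x}) (Y₁ ω₁ ∪ Y₂ ω₂)
      rw [Finset.sum_filter]
      refine Finset.sum_congr rfl fun ω₁ _ => ?_
      by_cases h1 : y ∈ X₁ ω₁
      · simp only [Ψ₂, h1, h, not_false_eq_true, and_self, if_true]
      · simp only [Ψ₂, h1, false_and, if_false]
    · rw [if_neg h]
      refine Finset.sum_eq_zero fun ω₁ _ => ?_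
      simp only [Ψ₂, h, and_false, if_false]
  let D₂ : Finset (Set (Sym2 V)) := Finset.univ.filter fun ω₂ => z ∉ Y₂ ω₂
  have hdbl : 0 ≤ ∑ ω₁, ∑ ω₂, Ψ₂ ω₁ ω₂ := by
    rw [Finset.sum_comm]
    simp_rw [hΦ]
    rw [← Finset.sum_filter]
    show 0 ≤ ∑ ω₂ ∈ D₂, Φ' ω₂
    -- block freezing of the BLUE cluster of `z` in side 2 (the red cluster of `z` in the complementary colouring)
    let Zc : Set (Sym2 V) → Set V := fun ω₂ => openCluster (ω₂ᶜ ∩ E₂) z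
    let meets : Set (Sym2 V) → Sym2 V → Prop := fun ω₂ e => ∃ v ∈ Zc ω₂, v ∈ e
    let P : Set (Sym2 V) → Finset (Set (Sym2 V)) := fun ω₂ =>
      Finset.univ.filter fun M => ∀ e, meets ω₂ e → (e ∈ M ↔ e ∈ ω₂)
    have hsD : ∀ ω₂ ∈ D₂, s ∉ Zc ω₂ := fun ω₂ hω hsZ =>
      (Finset.mem_filter.1 hω).2 (SimpleGraph.Reachable.symm hsZ)
    -- agreement on the block, transported to the complementary colourings
    have hagc : ∀ ω₂ M : Set (Sym2 V), (∀ e, meets ω₂ e → (e ∈ M ↔ e ∈ ω₂)) →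
        ∀ e : Sym2 V, (∃ v ∈ openCluster (ω₂ᶜ ∩ E₂) z, v ∈ e) → (e ∈ Mᶜ ↔ e ∈ ω₂ᶜ) := by
      intro ω₂ M hag e he
      rw [Set.mem_compl_iff, Set.mem_compl_iff]
      exact not_congr (hag e he)
    refine sum_nonneg_of_parts D₂ Φ' P ?_ ?_ ?_ ?_
    · intro ω₂ _
      exact Finset.mem_filter.2 ⟨Finset.mem_univ _, fun e _ => Iff.rfl⟩
    · intro ω₂ hω M hM
      have hag := (Finset.mem_filter.1 hM).2
      refine Finset.mem_filter.2 ⟨Finset.mem_univ _, ?_⟩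
      have := Freeze.not_reach_of_agree E₂ s z ω₂ᶜ Mᶜ (hsD ω₂ hω) (hagc ω₂ M hag)
      exact this
    · intro ω₂ _ M hM
      have hag := (Finset.mem_filter.1 hM).2
      have hZ : Zc M = Zc ω₂ := Freeze.cluster_eq_of_agree E₂ z ω₂ᶜ Mᶜ (hagc ω₂ M hag)
      ext M'
      simp only [P, Finset.mem_filter, Finset.mem_univ, true_and, meets]
      rw [hZ]
      constructor
      · intro h e he; rw [← hag e he]; exact h e he
      · intro h e he; rw [hag e he]; exact h e he
    · -- each part: a cube in the free pairs; side 2 red-dominated; compose with side 1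
      intro ω₂ hω
      have hs : s ∉ Zc ω₂ := hsD ω₂ hω
      let ι := {e : Sym2 V // ¬ meets ω₂ e}
      let N : Set (Sym2 V) := {e | e ∈ ω₂ ∧ meets ω₂ e}
      let emb : Set ι → Set (Sym2 V) := fun S => N ∪ {e | ∃ h : ¬ meets ω₂ e, (⟨e, h⟩ : ι) ∈ S}
      let proj : Set (Sym2 V) → Set ι := fun M => {p | p.1 ∈ M}
      have hemb_mono : Monotone emb := by
        intro S S' h e he
        rcases he with he | ⟨hne, hmem⟩
        · exact Or.inl he
        · exact Or.inr ⟨hne, h hmem⟩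
      -- complement of a member: the blue base plus the complementary free part
      have hcomplS : ∀ S : Set ι, (emb Sᶜ)ᶜ = {e | e ∈ ω₂ᶜ ∧ ∃ v ∈ openCluster (ω₂ᶜ ∩ E₂) z, v ∈ e} ∪
          {e | ∃ h : ¬ meets ω₂ e, (⟨e, h⟩ : ι) ∈ S} := by
        intro S; ext e
        simp only [emb, N, Set.mem_compl_iff, Set.mem_union, Set.mem_setOf_eq, not_or, not_exists]
        constructor
        · rintro ⟨h1, h2⟩
          by_cases hm : meets ω₂ e
          · exact Or.inl ⟨fun he => h1 ⟨he, hm⟩, hm⟩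
          · right; exact ⟨hm, not_not.1 (h2 hm)⟩
        · rintro (⟨h1, hm⟩ | ⟨hm, hS⟩)
          · exact ⟨fun h => h1 h.1, fun hm' => absurd hm hm'⟩
          · exact ⟨fun h => hm h.2, fun hm' hS' => hS' hS⟩
      have hdom : ∀ S : Set ι, Y₂ (emb Sᶜ) ⊆ X₂ (emb S) := by
        intro S v hv
        have hv' : v ∈ openCluster ((emb Sᶜ)ᶜ ∩ E₂) s := hv
        rw [hcomplS S] at hv'
        have h1 := Freeze.red_subset_of_free E₂ s z ω₂ᶜ hs {e | ∃ h : ¬ meets ω₂ e, (⟨e, h⟩ : ι) ∈ S}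
          (fun e he => he.1) hv'
        exact Freeze.openCluster_mono (Set.inter_subset_inter_left E₂ (fun e he => Or.inr he)) s h1
      -- transport the part sum to the cube
      have hbij : ∑ S : Set ι, Φ' (emb S) = ∑ M ∈ P ω₂, Φ' M := by
        refine Finset.sum_nbij' emb proj ?_ ?_ ?_ ?_ ?_
        · intro S _
          refine Finset.mem_filter.2 ⟨Finset.mem_univ _, fun e he => ?_⟩
          constructor
          · rintro (hN | ⟨hne, _⟩)
            · exact hN.1
            · exact absurd he hne
          · exact fun heω => Or.inl ⟨heω, he⟩
        · intro M _; exact Finset.mem_univ _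
        · intro S _
          ext p
          simp only [proj, emb, Set.mem_setOf_eq, Set.mem_union]
          constructor
          · rintro (hN | ⟨_, hp⟩)
            · exact absurd hN.2 p.2
            · exact hp
          · exact fun hp => Or.inr ⟨p.2, hp⟩
        · intro M hM
          have hag := (Finset.mem_filter.1 hM).2
          ext e
          simp only [proj, emb, N, Set.mem_setOf_eq, Set.mem_union]
          constructor
          · rintro (⟨heω, he⟩ | ⟨_, hp⟩)
            · exact (hag e he).2 heω
            · exact hp
          · intro heM
            by_cases he : meets ω₂ e
            · exact Or.inl ⟨(hag e he).1 heM, he⟩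
            · exact Or.inr ⟨he, heM⟩
        · intro S _; rfl
      rw [← hbij]
      -- unfold the part sum, swap, pass to the subtype of side-1 colourings with `y ∈ X₁`
      show 0 ≤ ∑ S : Set ι, ∑ ω₁ ∈ Finset.univ.filter (fun ω₁ : Set (Sym2 V) => y ∈ X₁ ω₁),
        hh (X₁ ω₁ ∪ X₂ (emb S) ∪ {x}) (Y₁ ω₁ ∪ Y₂ (emb S))
      rw [Finset.sum_comm]
      have hsub : ∀ (f : Set (Sym2 V) → ℝ), ∑ ω₁ ∈ Finset.univ.filter (fun ω₁ : Set (Sym2 V) => y ∈ X₁ ω₁), f ω₁ =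
          ∑ j : {ω₁ : Set (Sym2 V) // y ∈ X₁ ω₁}, f j.1 :=
        fun f => Finset.sum_subtype _ (fun ω₁ => by simp only [Finset.mem_filter, Finset.mem_univ, true_and]) f
      rw [hsub]
      have hplus' : ∀ K₁ K₂ : Set V → Set V → ℝ,
          (∀ ⦃P P' Q Q' : Set V⦄, P ⊆ P' → Q' ⊆ Q → K₁ P Q ≤ K₁ P' Q') → (∀ P Q, 0 ≤ K₁ P Q + K₁ Q P) →
          (∀ ⦃P P' Q Q' : Set V⦄, P ⊆ P' → Q' ⊆ Q → K₂ P Q ≤ K₂ P' Q') → (∀ P Q, 0 ≤ K₂ P Q + K₂ Q P) →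
          0 ≤ ∑ j : {ω₁ : Set (Sym2 V) // y ∈ X₁ ω₁}, K₁ (X₁ j.1) (Y₁ j.1) * K₂ (X₁ j.1) (Y₁ j.1) := by
        intro K₁ K₂ hK₁ hso₁ hK₂ hso₂
        have h := hplus K₁ K₂ hK₁ hso₁ hK₂ hso₂
        rw [hsub (fun ω₁ => K₁ (X₁ ω₁) (Y₁ ω₁) * K₂ (X₁ ω₁) (Y₁ ω₁))] at h
        exact h
      have hWr : Monotone (fun S : Set ι => X₂ (emb S)) := fun S S' h =>
        Freeze.openCluster_mono (Set.inter_subset_inter_left E₂ (hemb_mono h)) s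
      have hWb : Antitone (fun S : Set ι => Y₂ (emb S)) := fun S S' h =>
        Freeze.openCluster_mono (Set.inter_subset_inter_left E₂ (Set.compl_subset_compl.2 (hemb_mono h))) s
      have hF' : ∀ ⦃P P' Q Q' : Set V⦄, P ⊆ P' → Q' ⊆ Q → F P - F Q ≤ F P' - F Q' :=
        fun P P' Q Q' hP hQ => sub_le_sub (hF hP) (hF hQ)
      have hG' : ∀ ⦃P P' Q Q' : Set V⦄, P ⊆ P' → Q' ⊆ Q → G P - G Q ≤ G P' - G Q' :=
        fun P P' Q Q' hP hQ => sub_le_sub (hG hP) (hG hQ)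
      have h := oplus_composition_sum_nonneg (fun j : {ω₁ : Set (Sym2 V) // y ∈ X₁ ω₁} => X₁ j.1)
        (fun j => Y₁ j.1) hplus' (fun S : Set ι => X₂ (emb S)) (fun S => Y₂ (emb S)) hWr hWb hdom {x}
        (h₁ := fun P Q => F P - F Q) (h₂ := fun P Q => G P - G Q) hF' (fun P Q => by ring) hG' (fun P Q => by ring)
      exact h
  -- (4) conclude
  rw [hdiag]
  have hN : (0 : ℝ) < (Fintype.card (Set (Sym2 V)) : ℝ) := by exact_mod_cast Fintype.card_pos
  rw [hrel] at hdbl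
  exact (mul_nonneg_iff_of_pos_left hN).1 hdbl

/-- **THEOREM OS⊕-C with the sides listed in the other order** (`E₂ ∪ E₁`, the ⊕-positive side `E₁` still the one containing `y`):
the convenience form for assemblies whose edge set is written with the `z`-side first (prim-hp-2 gen 59). [this work] -/
theorem cutVertex_termTwo_nonneg_comm (E₁ E₂ : Set (Sym2 V)) (s y z x : V) (U₁ U₂ : Set V) (hU : Disjoint U₁ U₂) (hs₁ : s ∉ U₁)
    (hs₂ : s ∉ U₂) (hE₁ : ∀ e ∈ E₁, ∀ v ∈ e, v = s ∨ v ∈ U₁) (hE₂ : ∀ e ∈ E₂, ∀ v ∈ e, v = s ∨ v ∈ U₂)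
    (hdis : Disjoint E₁ E₂) (hy : y ∈ U₁) (hz : z ∈ U₂)
    (hplus : ∀ K₁ K₂ : Set V → Set V → ℝ,
      (∀ ⦃P P' Q Q' : Set V⦄, P ⊆ P' → Q' ⊆ Q → K₁ P Q ≤ K₁ P' Q') → (∀ P Q, 0 ≤ K₁ P Q + K₁ Q P) →
      (∀ ⦃P P' Q Q' : Set V⦄, P ⊆ P' → Q' ⊆ Q → K₂ P Q ≤ K₂ P' Q') → (∀ P Q, 0 ≤ K₂ P Q + K₂ Q P) →
      0 ≤ ∑ ω ∈ Finset.univ.filter (fun ω : Set (Sym2 V) => y ∈ openCluster (ω ∩ E₁) s),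
        K₁ (openCluster (ω ∩ E₁) s) (openCluster (ωᶜ ∩ E₁) s) * K₂ (openCluster (ω ∩ E₁) s) (openCluster (ωᶜ ∩ E₁) s))
    {F G : Set V → ℝ} (hF : Monotone F) (hG : Monotone G) :
    0 ≤ ∑ ω ∈ Finset.univ.filter (fun ω : Set (Sym2 V) =>
        (openGraph (ω ∩ (E₂ ∪ E₁))).Reachable s y ∧ ¬ (openGraph (ωᶜ ∩ (E₂ ∪ E₁))).Reachable s z),
      (F (openCluster (ω ∩ (E₂ ∪ E₁)) s ∪ {x}) - F (openCluster (ωᶜ ∩ (E₂ ∪ E₁)) s)) *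
        (G (openCluster (ω ∩ (E₂ ∪ E₁)) s ∪ {x}) - G (openCluster (ωᶜ ∩ (E₂ ∪ E₁)) s)) := by
  rw [Set.union_comm E₂ E₁]
  exact cutVertex_termTwo_nonneg E₁ E₂ s y z x U₁ U₂ hU hs₁ hs₂ hE₁ hE₂ hdis hy hz hplus hF hG

end Main

/-- Grafting identities on the `E₂` side (the `have`s of `cutVertex_termTwo_nonneg` as lemmas, reused by the two-stage Harris theorem;
prim-hp-2 gen 59): `((a ∖ E₂) ∪ (b ∩ E₂)) ∩ E₂ = b ∩ E₂` and `((a ∖ E₂) ∪ (b ∩ E₂))ᶜ ∩ E₂ = bᶜ ∩ E₂`. [folklore] -/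
theorem graft_inter_right {E₂ : Set (Sym2 V)} (a b : Set (Sym2 V)) :
    ((a \ E₂) ∪ (b ∩ E₂)) ∩ E₂ = b ∩ E₂ ∧ ((a \ E₂) ∪ (b ∩ E₂))ᶜ ∩ E₂ = bᶜ ∩ E₂ := by
  constructor <;> ext e <;> simp only [Set.mem_inter_iff, Set.mem_compl_iff, Set.mem_union, Set.mem_sdiff] <;> tauto

end Cut

end Antithetic

end Summit.CriticalPhenomena.PercolationContinuityZ3.Theorems
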